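import Mathlib.Algebra.Group.Submonoid.Basic
import Mathlib.Algebra.Group.Subgroup.ZPowers.Basic
import Mathlib.Algebra.BigOperators.Fin
import Mathlib.Data.Finsupp.Basic
import Mathlib.Data.Finsupp.Order
import Mathlib.Tactic.Abel
import HarnessLib

/-!
# Crux `FrobeniusLadder.FRationalResolution` (stmt-ResolutionOfSingularities-15317), line `redirect`,
# stub `stub_diagonalizableQuotientResolution` — THE MEMBERSHIP FAMILIES OF A CONE CERTIFICATE FROM CHECKS ON GENERATORS
# (item (β-cert) of MEMO-15317-leafhand2-g25 §3: everything infinite in a class certificate reduced to finite data)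

The cone certificate consumed by `…ConeCertificateResolution.hasResolution_of_isolated_fixedPoints_of_unimodularConeCertificate`
(p843926) contains, per vertex `v` of the weight kernel `P = ⟨G⟩ ⊆ ℕⁿ` and its chart cone monoid `(Q = ⟨G_Q⟩ ⊆ ℕ^{n'}, ι : Q → ℤⁿ)`,
three families quantified over ALL of `P` or `Q`:
(hPQ) every `p ∈ P` is an `ι u`; (hE) every `e − v` (`0 ≠ e ∈ P`) is an `ι u`; (hQ) every `ι u` is `p + Σ (eᵢ − v)`;
and per face generator `g ∈ G_Q` with face monoid `(M, ι' : M → ℤ^{n'})`: (hM) every `ι' w` is `q − k g`; (hQM) every `q ∈ Q` is an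
`ι' w`. Each family follows from its instances at the GENERATORS (`G`, `G_Q`, a generating set of `M`) by additivity — this file:

* `forall_exists_eq_of_generators` (hPQ), `forall_exists_eq_sub_of_generators` (hE), `forall_exists_decomp_of_generators` (hQ);
* `face_forall_of_generators` (hM, any generating set `T` of `M`), `face_forall_exists_eq_of_generators` (hQM);
* `closure_prodGenerators_eq_top` — the standard generators `(eᵢ, 0), (0, ±fⱼ)` of `ℕᵃ × ℤᵇ` (the face monoids of unimodular faces);
* `injective_of_leftInverse_on_generators` — injectivity of `ι' : ℕᵃ × ℤᵇ → ℤ^{n'}` from an additive left inverse checked on the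
  standard generators.

Honest label: generic combinatorial helper toward ONE leaf stub (no stub, crux or summit closed). No definitions, no named facts,
no sorry. [folklore; cite: CoxLittleSchenck2011, §1.1, §1.2]
-/

-- single-problem summit: the doubled namespace component is forced
set_option linter.dupNamespace false

open scoped BigOperators

namespace Summit.ResolutionOfSingularities.ResolutionOfSingularities.Theorems.FRationalResolution.ConeCertificateGenerators

/-- The exponent of `p ∈ ℕⁿ` in `ℤⁿ`. -/
local notation3 (prettyPrint := false) "toZ[" n "]" =>
  (Finsupp.mapRange.addMonoidHom (Nat.castAddMonoidHom ℤ) : (Fin n →₀ ℕ) →+ (Fin n →₀ ℤ))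

variable {n n' : ℕ} (P : AddSubmonoid (Fin n →₀ ℕ)) (Q : AddSubmonoid (Fin n' →₀ ℕ))

/-! ## §1 The three families of the chart cone -/

/-- **(hPQ) from generators**: if every `g ∈ G` (`⟨G⟩ = P`) is an `ι u`, so is every `p ∈ P`. [folklore] -/
theorem forall_exists_eq_of_generators {N : Type} [AddCommMonoid N] (ι : ↥Q →+ N) (τ : (Fin n →₀ ℕ) →+ N)
    (G : Set (Fin n →₀ ℕ)) (hGP : AddSubmonoid.closure G = P)
    (hG : ∀ g ∈ G, ∃ u : ↥Q, ι u = τ g) : ∀ p : ↥P, ∃ u : ↥Q, ι u = τ (p : Fin n →₀ ℕ) := by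
  intro p
  have hp : (p : Fin n →₀ ℕ) ∈ AddSubmonoid.closure G := hGP ▸ p.2
  suffices key : ∀ x, x ∈ AddSubmonoid.closure G → ∃ u : ↥Q, ι u = τ x from key _ hp
  intro x hx
  induction hx using AddSubmonoid.closure_induction with
  | mem x hx => exact hG x hx
  | zero => exact ⟨0, by rw [map_zero, map_zero]⟩
  | add x y _ _ ihx ihy =>
    obtain ⟨u₁, hu₁⟩ := ihx
    obtain ⟨u₂, hu₂⟩ := ihy
    exact ⟨u₁ + u₂, by rw [map_add, map_add, hu₁, hu₂]⟩

/-- **(hE) from generators**: if every `g − v` (`g ∈ G`, `⟨G⟩ = P`) is an `ι u` and (hPQ) holds, then every `e − v` (`0 ≠ e ∈ P`) is an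
`ι u`. [folklore] -/
theorem forall_exists_eq_sub_of_generators {N : Type} [AddCommGroup N] (ι : ↥Q →+ N) (τ : (Fin n →₀ ℕ) →+ N)
    (G : Set (Fin n →₀ ℕ)) (hGP : AddSubmonoid.closure G = P) (v : N)
    (hG : ∀ g ∈ G, ∃ u : ↥Q, ι u = τ g - v) (hPQ : ∀ p : ↥P, ∃ u : ↥Q, ι u = τ (p : Fin n →₀ ℕ)) :
    ∀ e : ↥P, e ≠ 0 → ∃ u : ↥Q, ι u = τ (e : Fin n →₀ ℕ) - v := by
  intro e he
  have hp : (e : Fin n →₀ ℕ) ∈ AddSubmonoid.closure G := hGP ▸ e.2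
  have he' : (e : Fin n →₀ ℕ) ≠ 0 := fun h => he (Subtype.ext h)
  -- a non-zero element of `⟨G⟩` is `g + p` with `g ∈ G`, `p ∈ ⟨G⟩`
  have key : ∀ x, x ∈ AddSubmonoid.closure G → x = 0 ∨ ∃ g ∈ G, ∃ p ∈ AddSubmonoid.closure G, x = g + p := by
    intro x hx
    induction hx using AddSubmonoid.closure_induction with
    | mem x hx => exact Or.inr ⟨x, hx, 0, zero_mem _, (add_zero x).symm⟩
    | zero => exact Or.inl rfl
    | add x y hx hy ihx ihy =>
      rcases ihx with hx0 | ⟨g, hg, p, hp, hxe⟩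
      · rcases ihy with hy0 | ⟨g, hg, p, hp, hye⟩
        · exact Or.inl (by rw [hx0, hy0, add_zero])
        · exact Or.inr ⟨g, hg, p, hp, by rw [hx0, zero_add, hye]⟩
      · exact Or.inr ⟨g, hg, p + y, add_mem hp hy, by rw [hxe, add_assoc]⟩
  rcases key _ hp with h0 | ⟨g, hg, p, hp', hep⟩
  · exact absurd h0 he'
  obtain ⟨u₁, hu₁⟩ := hG g hg
  obtain ⟨u₂, hu₂⟩ := hPQ ⟨p, hGP ▸ hp'⟩
  have hu₂' : ι u₂ = τ p := hu₂
  refine ⟨u₁ + u₂, ?_⟩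
  rw [map_add, hu₁, hu₂', hep, map_add]
  abel

/-- **(hQ) from generators**: if every generator `g ∈ G_Q` (`⟨G_Q⟩ = Q`) has `ι g = p + Σᵢ (eᵢ − v)` (`p ∈ P`, `0 ≠ eᵢ ∈ P`), so does
every `u ∈ Q` (concatenate the lists). [folklore] -/
theorem forall_exists_decomp_of_generators {N : Type} [AddCommGroup N] (ι : ↥Q →+ N) (τ : (Fin n →₀ ℕ) →+ N) (v : N)
    (GQ : Set (Fin n' →₀ ℕ)) (hGQ : AddSubmonoid.closure GQ = Q)
    (hG : ∀ u : ↥Q, (u : Fin n' →₀ ℕ) ∈ GQ → ∃ (p : ↥P) (r : ℕ) (e : Fin r → ↥P), (∀ i, e i ≠ 0) ∧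
      ι u = τ (p : Fin n →₀ ℕ) + ∑ i, (τ ((e i : ↥P) : Fin n →₀ ℕ) - v)) :
    ∀ u : ↥Q, ∃ (p : ↥P) (r : ℕ) (e : Fin r → ↥P), (∀ i, e i ≠ 0) ∧
      ι u = τ (p : Fin n →₀ ℕ) + ∑ i, (τ ((e i : ↥P) : Fin n →₀ ℕ) - v) := by
  intro u
  have hu : (u : Fin n' →₀ ℕ) ∈ AddSubmonoid.closure GQ := hGQ ▸ u.2
  -- predicate quantified over the membership proof, so that the induction is over plain elements
  suffices key : ∀ x, x ∈ AddSubmonoid.closure GQ → ∀ hx : x ∈ Q, ∃ (p : ↥P) (r : ℕ) (e : Fin r → ↥P), (∀ i, e i ≠ 0) ∧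
      ι ⟨x, hx⟩ = τ (p : Fin n →₀ ℕ) + ∑ i, (τ ((e i : ↥P) : Fin n →₀ ℕ) - v) from key _ hu u.2
  intro x hx
  induction hx using AddSubmonoid.closure_induction with
  | mem x hx => exact fun hxQ => hG ⟨x, hxQ⟩ hx
  | zero =>
    intro h0
    refine ⟨0, 0, Fin.elim0, fun i => i.elim0, ?_⟩
    have : (⟨0, h0⟩ : ↥Q) = 0 := rfl
    rw [this, map_zero, ZeroMemClass.coe_zero, map_zero, Finset.univ_eq_empty, Finset.sum_empty, add_zero]
  | add x y hx hy ihx ihy =>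
    intro hxy
    have hxQ : x ∈ Q := hGQ ▸ hx
    have hyQ : y ∈ Q := hGQ ▸ hy
    obtain ⟨p₁, r₁, e₁, he₁, h₁⟩ := ihx hxQ
    obtain ⟨p₂, r₂, e₂, he₂, h₂⟩ := ihy hyQ
    refine ⟨p₁ + p₂, r₁ + r₂, Fin.append e₁ e₂, ?_, ?_⟩
    · refine Fin.addCases (fun i => ?_) (fun i => ?_)
      · rw [Fin.append_left]; exact he₁ i
      · rw [Fin.append_right]; exact he₂ i
    · have hsplit : (⟨x + y, hxy⟩ : ↥Q) = ⟨x, hxQ⟩ + ⟨y, hyQ⟩ := rfl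
      rw [hsplit, map_add, h₁, h₂, Fin.sum_univ_add]
      simp only [Fin.append_left, Fin.append_right, AddSubmonoid.coe_add, map_add]
      abel

/-! ## §2 The two families of a face -/

/-- **(hM) from generators**: `M` any additive monoid generated by `T`; if every `t ∈ T` has `ι' t + k • g = q` (`q ∈ Q`), so does every
`w ∈ M`. [folklore] -/
theorem face_forall_of_generators {M N : Type} [AddCommMonoid M] [AddCommMonoid N] (ι' : M →+ N) (g : N) (σ : ↥Q → N)
    (hσ0 : σ 0 = 0) (hσ : ∀ q q' : ↥Q, σ (q + q') = σ q + σ q')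
    (T : Set M) (hT : AddSubmonoid.closure T = ⊤)
    (hgen : ∀ t ∈ T, ∃ (q : ↥Q) (k : ℕ), ι' t + k • g = σ q) :
    ∀ w : M, ∃ (q : ↥Q) (k : ℕ), ι' w + k • g = σ q := by
  intro w
  have hw : w ∈ AddSubmonoid.closure T := by rw [hT]; exact AddSubmonoid.mem_top w
  induction hw using AddSubmonoid.closure_induction with
  | mem x hx => exact hgen x hx
  | zero => exact ⟨0, 0, by rw [map_zero, zero_smul, add_zero, hσ0]⟩
  | add x y _ _ ihx ihy =>
    obtain ⟨q₁, k₁, h₁⟩ := ihx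
    obtain ⟨q₂, k₂, h₂⟩ := ihy
    refine ⟨q₁ + q₂, k₁ + k₂, ?_⟩
    rw [map_add, add_smul, hσ, ← h₁, ← h₂]
    abel

/-- **(hQM) from generators**: if every generator `g' ∈ G_Q` (`⟨G_Q⟩ = Q`) is an `ι' w`, so is every `q ∈ Q`. [folklore] -/
theorem face_forall_exists_eq_of_generators {M N : Type} [AddCommMonoid M] [AddCommMonoid N] (ι' : M →+ N)
    (τ' : (Fin n' →₀ ℕ) →+ N) (GQ : Set (Fin n' →₀ ℕ)) (hGQ : AddSubmonoid.closure GQ = Q)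
    (hgen : ∀ u : ↥Q, (u : Fin n' →₀ ℕ) ∈ GQ → ∃ w : M, ι' w = τ' (u : Fin n' →₀ ℕ)) :
    ∀ q : ↥Q, ∃ w : M, ι' w = τ' (q : Fin n' →₀ ℕ) := by
  intro q
  have hq : (q : Fin n' →₀ ℕ) ∈ AddSubmonoid.closure GQ := hGQ ▸ q.2
  suffices key : ∀ x, x ∈ AddSubmonoid.closure GQ → x ∈ Q → ∃ w : M, ι' w = τ' x from key _ hq q.2
  intro x hx
  induction hx using AddSubmonoid.closure_induction with
  | mem x hx => exact fun hxQ => hgen ⟨x, hxQ⟩ hx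
  | zero => exact fun _ => ⟨0, by rw [map_zero, map_zero]⟩
  | add x y hx hy ihx ihy =>
    intro _
    obtain ⟨w₁, h₁⟩ := ihx (hGQ ▸ hx)
    obtain ⟨w₂, h₂⟩ := ihy (hGQ ▸ hy)
    exact ⟨w₁ + w₂, by rw [map_add, map_add, h₁, h₂]⟩

/-! ## §3 The standard generators of `ℕᵃ × ℤᵇ` -/

/-- **`ℕᵃ × ℤᵇ` is generated, as an additive monoid, by `(eᵢ, 0)`, `(0, fⱼ)` and `(0, −fⱼ)`.** [folklore] -/
theorem closure_prodGenerators_eq_top (a b : ℕ) :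
    AddSubmonoid.closure ((Set.range fun i : Fin a => ((Finsupp.single i 1, 0) : (Fin a →₀ ℕ) × (Fin b →₀ ℤ))) ∪
      (Set.range fun j : Fin b => ((0, Finsupp.single j 1) : (Fin a →₀ ℕ) × (Fin b →₀ ℤ))) ∪
      (Set.range fun j : Fin b => ((0, -Finsupp.single j 1) : (Fin a →₀ ℕ) × (Fin b →₀ ℤ)))) = ⊤ := by
  set S : Set ((Fin a →₀ ℕ) × (Fin b →₀ ℤ)) := (Set.range fun i : Fin a => ((Finsupp.single i 1, 0) : (Fin a →₀ ℕ) × (Fin b →₀ ℤ))) ∪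
      (Set.range fun j : Fin b => ((0, Finsupp.single j 1) : (Fin a →₀ ℕ) × (Fin b →₀ ℤ))) ∪
      (Set.range fun j : Fin b => ((0, -Finsupp.single j 1) : (Fin a →₀ ℕ) × (Fin b →₀ ℤ))) with hS
  -- the three kinds of generators lie in the closure
  have hgA : ∀ i : Fin a, ((Finsupp.single i 1, 0) : (Fin a →₀ ℕ) × (Fin b →₀ ℤ)) ∈ AddSubmonoid.closure S := fun i =>
    AddSubmonoid.subset_closure (show _ ∈ S from Or.inl (Or.inl ⟨i, rfl⟩))
  have hgB : ∀ j : Fin b, ((0, Finsupp.single j 1) : (Fin a →₀ ℕ) × (Fin b →₀ ℤ)) ∈ AddSubmonoid.closure S := fun j =>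
    AddSubmonoid.subset_closure (show _ ∈ S from Or.inl (Or.inr ⟨j, rfl⟩))
  have hgB' : ∀ j : Fin b, ((0, -Finsupp.single j 1) : (Fin a →₀ ℕ) × (Fin b →₀ ℤ)) ∈ AddSubmonoid.closure S := fun j =>
    AddSubmonoid.subset_closure (show _ ∈ S from Or.inr ⟨j, rfl⟩)
  -- multiples of the generators, by induction on the multiplicity
  have hA : ∀ (i : Fin a) (c : ℕ), ((Finsupp.single i c, 0) : (Fin a →₀ ℕ) × (Fin b →₀ ℤ)) ∈ AddSubmonoid.closure S := by
    intro i c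
    induction c with
    | zero => rw [Finsupp.single_zero, Prod.mk_zero_zero]; exact zero_mem _
    | succ c ih =>
      have : ((Finsupp.single i (c + 1), 0) : (Fin a →₀ ℕ) × (Fin b →₀ ℤ)) = (Finsupp.single i c, 0) + (Finsupp.single i 1, 0) := by
        rw [Prod.mk_add_mk, add_zero, Finsupp.single_add]
      rw [this]
      exact add_mem ih (hgA i)
  have hB : ∀ (j : Fin b) (c : ℕ), ((0, Finsupp.single j (c : ℤ)) : (Fin a →₀ ℕ) × (Fin b →₀ ℤ)) ∈ AddSubmonoid.closure S := by
    intro j c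
    induction c with
    | zero => rw [Nat.cast_zero, Finsupp.single_zero, Prod.mk_zero_zero]; exact zero_mem _
    | succ c ih =>
      have : ((0, Finsupp.single j ((c + 1 : ℕ) : ℤ)) : (Fin a →₀ ℕ) × (Fin b →₀ ℤ)) =
          (0, Finsupp.single j (c : ℤ)) + (0, Finsupp.single j 1) := by
        rw [Prod.mk_add_mk, add_zero, ← Finsupp.single_add, Nat.cast_succ]
      rw [this]
      exact add_mem ih (hgB j)
  have hB' : ∀ (j : Fin b) (c : ℕ), ((0, -Finsupp.single j (c : ℤ)) : (Fin a →₀ ℕ) × (Fin b →₀ ℤ)) ∈ AddSubmonoid.closure S := by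
    intro j c
    induction c with
    | zero => rw [Nat.cast_zero, Finsupp.single_zero, neg_zero, Prod.mk_zero_zero]; exact zero_mem _
    | succ c ih =>
      have : ((0, -Finsupp.single j ((c + 1 : ℕ) : ℤ)) : (Fin a →₀ ℕ) × (Fin b →₀ ℤ)) =
          (0, -Finsupp.single j (c : ℤ)) + (0, -Finsupp.single j 1) := by
        rw [Prod.mk_add_mk, add_zero, ← neg_add, ← Finsupp.single_add, Nat.cast_succ]
      rw [this]
      exact add_mem ih (hgB' j)
  -- the first factor
  have h1 : ∀ x : Fin a →₀ ℕ, ((x, 0) : (Fin a →₀ ℕ) × (Fin b →₀ ℤ)) ∈ AddSubmonoid.closure S := by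
    intro x
    induction x using Finsupp.induction with
    | zero => rw [Prod.mk_zero_zero]; exact zero_mem _
    | single_add i c x _ _ ih =>
      have : ((Finsupp.single i c + x, 0) : (Fin a →₀ ℕ) × (Fin b →₀ ℤ)) = (Finsupp.single i c, 0) + (x, 0) := by
        rw [Prod.mk_add_mk, add_zero]
      rw [this]
      exact add_mem (hA i c) ih
  -- the second factor
  have h2 : ∀ y : Fin b →₀ ℤ, ((0, y) : (Fin a →₀ ℕ) × (Fin b →₀ ℤ)) ∈ AddSubmonoid.closure S := by
    intro y
    induction y using Finsupp.induction with
    | zero => rw [Prod.mk_zero_zero]; exact zero_mem _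
    | single_add j c y _ _ ih =>
      have hc : Finsupp.single j c = Finsupp.single j (c.toNat : ℤ) + -Finsupp.single j ((-c).toNat : ℤ) := by
        rw [← sub_eq_add_neg, ← Finsupp.single_sub, Int.toNat_sub_toNat_neg]
      have : ((0, Finsupp.single j c + y) : (Fin a →₀ ℕ) × (Fin b →₀ ℤ)) =
          ((0, Finsupp.single j (c.toNat : ℤ)) + (0, -Finsupp.single j ((-c).toNat : ℤ))) + (0, y) := by
        rw [Prod.mk_add_mk, Prod.mk_add_mk, add_zero, add_zero, ← hc]
      rw [this]
      exact add_mem (add_mem (hB j _) (hB' j _)) ih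
  refine eq_top_iff.2 fun w _ => ?_
  have : w = (w.1, 0) + (0, w.2) := by rw [Prod.mk_add_mk, add_zero, zero_add]
  rw [this]
  exact add_mem (h1 w.1) (h2 w.2)

/-- **Injectivity from a left inverse checked on generators**: `ι' : ℕᵃ × ℤᵇ → N` (`N` a group) is injective as soon as some additive
`L : N → ℤᵃ × ℤᵇ` satisfies `L (ι' (eᵢ, 0)) = (eᵢ, 0)` and `L (ι' (0, fⱼ)) = (0, fⱼ)`. [folklore] -/
theorem injective_of_leftInverse_on_generators {N : Type} [AddCommGroup N] (a b : ℕ)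
    (ι' : ((Fin a →₀ ℕ) × (Fin b →₀ ℤ)) →+ N) (L : N →+ (Fin a →₀ ℤ) × (Fin b →₀ ℤ))
    (hA : ∀ i : Fin a, L (ι' (Finsupp.single i 1, 0)) = (Finsupp.single i 1, 0))
    (hB : ∀ j : Fin b, L (ι' (0, Finsupp.single j 1)) = (0, Finsupp.single j 1)) :
    Function.Injective ι' := by
  -- the coordinate embedding `ℕᵃ × ℤᵇ → ℤᵃ × ℤᵇ`
  let emb : ((Fin a →₀ ℕ) × (Fin b →₀ ℤ)) →+ (Fin a →₀ ℤ) × (Fin b →₀ ℤ) :=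
    AddMonoidHom.prodMap (Finsupp.mapRange.addMonoidHom (Nat.castAddMonoidHom ℤ)) (AddMonoidHom.id _)
  have hemb1 : ∀ i : Fin a, emb (Finsupp.single i 1, 0) = (Finsupp.single i 1, 0) := by
    intro i
    simp [emb]
  have hemb2 : ∀ y : Fin b →₀ ℤ, emb (0, y) = (0, y) := by
    intro y
    simp [emb]
  have hemb : Function.Injective emb := by
    rintro ⟨x₁, y₁⟩ ⟨x₂, y₂⟩ h
    have h' : (Finsupp.mapRange.addMonoidHom (Nat.castAddMonoidHom ℤ) x₁, y₁) =
        (Finsupp.mapRange.addMonoidHom (Nat.castAddMonoidHom ℤ) x₂, y₂) := h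
    obtain ⟨h₁, h₂⟩ := Prod.mk.inj h'
    refine Prod.ext ?_ h₂
    refine Finsupp.mapRange_injective (Nat.castAddMonoidHom ℤ) (map_zero _) (fun m n hmn => ?_)
      (by simpa only [Finsupp.mapRange.addMonoidHom_apply] using h₁)
    simpa using hmn
  -- `ι'` kills nothing on the negative generators either
  have hB' : ∀ j : Fin b, L (ι' (0, -Finsupp.single j 1)) = (0, -Finsupp.single j 1) := by
    intro j
    have hneg : ι' (0, -Finsupp.single j 1) = -ι' (0, Finsupp.single j 1) := by
      refine eq_neg_of_add_eq_zero_left ?_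
      rw [← map_add, Prod.mk_add_mk, add_zero, neg_add_cancel, Prod.mk_zero_zero, map_zero]
    rw [hneg, map_neg, hB, Prod.neg_mk, neg_zero]
  -- `L ∘ ι' = emb` on generators, hence everywhere
  have hcomp : L.comp ι' = emb := by
    refine AddMonoidHom.eq_of_eqOn_denseM (closure_prodGenerators_eq_top a b) ?_
    rintro t ((⟨i, rfl⟩ | ⟨j, rfl⟩) | ⟨j, rfl⟩)
    · rw [AddMonoidHom.comp_apply, hA, hemb1]
    · rw [AddMonoidHom.comp_apply, hB, hemb2]
    · rw [AddMonoidHom.comp_apply, hB', hemb2]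
  intro w₁ w₂ h
  apply hemb
  rw [← hcomp, AddMonoidHom.comp_apply, AddMonoidHom.comp_apply, h]

end Summit.ResolutionOfSingularities.ResolutionOfSingularities.Theorems.FRationalResolution.ConeCertificateGenerators
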